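import Summits.Ventures.HSemireg.WedgeHankelDivisorRank
import Summits.Ventures.HSemireg.WedgeHankelConfluentRank

/-!
# Venture HSemireg — THE DIVISOR IMAGE LAW: the image of `θ ↦ θ ∧ (Σ_i exp(λ_i Θ)·p_i(Θ))` on `⋀^k` is the DIRECT SUM of the images of the nodes
# `exp(λ_i Θ)·p_i(Θ)` — total order `Σ_i (P_i + 1) ≤ min(k + 1, n + 1 − k)`; dual to F2b's «the kernel is the intersection of the node kernels»

HONEST FRAMING. Part of the Lean index of the computation cell `pub-hsemireg` (seat p10 gen 16, Sunday typer «UNIFORM-IN-n»).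
Finite-dimensional EXTERIOR ALGEBRA over a field ONLY: no variety, no cohomology theory, no sheaf, no Ext group, no semiregularity map;
nothing here says that HC / HC_CM / HC_AV holds; no Literature fact is declared or used.  Custodian versions as in `WedgeHankelSiegelIdeal` (1/3) and
`WedgeHankelFrameChange`; the dictionary (`V(univ, w_n(q), k)` ↔ the image of `⌟v` on `H^•(⋀^• T)` in total degree `k`; divisor of a class) is QUOTED, never asserted.

WHAT IS IN THE TREE / KEYED.  THEOREM H (`finrank_Kr_w_add_rank`, E6): `dim V(univ, w_n(q), k) = C(n,k)·rank H_k(q)`; F2a `rank_hankel1_expMul_sum`: the rank of a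
divisor class is its total order `D`; E5 `V_w_expMul`: `V(univ, w_n(expMul λ q), k) = Φs λ (V(univ, w_n(q), k))`.  THIS FILE (no duality needed — a count):
* §57 `V_w_sum_le_iSup`: the image of a sum of classes lies in the sum of the images; `finrank_V_w`: `dim V(univ, w_n(q), k) = C(n,k)·rank H_k(q)`
  (a finite sum of subspaces has dimension at most the sum of the dimensions).
* §58 **THE DIVISOR IMAGE LAW `V_w_expMul_sum`**: distinct `λ_i`, `q_i` of exact order `P_i`, `D = Σ_i (P_i+1) ≤ k + 1` and `D ≤ n + 1 − k` ⇒
  **`V(univ, w_n(Σ_i expMul λ_i q_i), k) = ⨆_i V(univ, w_n(expMul λ_i q_i), k)`**, the sum has dimension `Σ_i dim V_i = C(n,k)·D` (`finrank_iSup_V_w_expMul`),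
  and it is DIRECT: **`iSupIndep_V_w_expMul`** — each node's image `Φs λ_i (V(univ, w_n(q_i), k))` (E5's `V_w_expMul`) meets the sum of the others in `0`.
NOT typed here: the NAME of a single node's image (E1's annihilator of `SI ⊔ xRich`; a sequel); a node at `∞`; `D > min(k+1, n+1−k)`.
Class side only.  Namespace `Summit.Ventures.HSemireg.Wedge.HankelFrameChange` (continued); new names only.
-/

open Module

namespace Summit.Ventures.HSemireg.Wedge.HankelFrameChange

open Summit.Ventures.HSemireg.Wedge Summit.Ventures.HSemireg.Wedge.Kunneth Summit.Ventures.HSemireg.Wedge.Hankel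
  Summit.Ventures.HSemireg.Wedge.HankelSiegel Summit.Ventures.HSemireg.Wedge.HankelSiegelIdeal Summit.Ventures.HSemireg.Wedge.KunnethKernel

variable (K : Type*) [Field K] {n : ℕ}

/-! ## §57. Images add; their dimensions -/

/-- th-7's class of a finite sum of coefficient sequences is the sum of the classes (as in F2b; private copy to keep the imports disjoint). -/
private lemma w_finsum' {ι : Type*} (s : Finset ι) (q : ι → ℕ → K) (m : ℕ) :
    w K n m (fun j => ∑ i ∈ s, q i j) = ∑ i ∈ s, w K n m (q i) := by
  have e : (fun j => ∑ i ∈ s, q i j) = fun j => ∑ i ∈ s, (1 : K) * q i j := by funext j; simp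
  rw [e, w_sum_smul]; simp

/-- **THE IMAGE OF A SUM LIES IN THE SUM OF THE IMAGES: `V(univ, w_n(Σ_i q_i), k) ≤ ⨆_i V(univ, w_n(q_i), k)`.** -/
theorem V_w_sum_le_iSup {r : ℕ} (q : Fin r → ℕ → K) (k : ℕ) :
    V K (In n) Finset.univ (w K n n (fun j => ∑ i, q i j)) k ≤ ⨆ i, V K (In n) Finset.univ (w K n n (q i)) k := by
  rw [V_eq_map, Submodule.map_le_iff_le_comap]
  intro θ hθ
  rw [Submodule.mem_comap, LinearMap.mulRight_apply, w_finsum', Finset.mul_sum]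
  refine Submodule.sum_mem _ fun i _ => ?_
  have hi : θ * w K n n (q i) ∈ V K (In n) Finset.univ (w K n n (q i)) k := by
    rw [V_eq_map]; exact ⟨θ, hθ, rfl⟩
  exact (le_iSup (fun i => V K (In n) Finset.univ (w K n n (q i)) k) i) hi

/-- **`dim V(univ, w_n(q), k) = C(n,k)·rank H_k(q)`** (THEOREM H). -/
theorem finrank_V_w (k : ℕ) (q : ℕ → K) : finrank K (V K (In n) Finset.univ (w K n n q) k) = n.choose k * (hankel1 K n k q).rank := by
  have h1 := finrank_Kr_add_finrank_V K (Finset.univ : Finset (In n)) (w K n n q) k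
  have h2 := finrank_Kr_w_add_rank K (n := n) k q
  rw [Finset.card_univ, Fintype.card_fin] at h1
  omega

/-- the dimension of a finite sum of subspaces is at most the sum of the dimensions (private; generic). -/
private theorem finrank_finset_sup_le {M : Type*} [AddCommGroup M] [Module K M] [FiniteDimensional K M] {ι : Type*} (s : Finset ι) (F : ι → Submodule K M) :
    finrank K ↥(s.sup F) ≤ ∑ i ∈ s, finrank K (F i) := by
  classical
  induction s using Finset.induction_on with
  | empty => rw [Finset.sup_empty, finrank_bot, Finset.sum_empty]
  | insert a s ha ih =>
    rw [Finset.sup_insert, Finset.sum_insert ha]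
    exact (Submodule.finrank_add_le_finrank_add_finrank _ _).trans (Nat.add_le_add_left ih _)

/-! ## §58. The divisor image law -/

/-- the dimension of ONE node's image: `dim V(univ, w_n(expMul λ q), k) = (P + 1)·C(n,k)` for exact order `P ≤ k`, `k + P ≤ n`. -/
theorem finrank_V_w_expMul_of_order (lam : K) {k P : ℕ} (hPk : P ≤ k) (hkP : k + P ≤ n) {q : ℕ → K} (hq : ∀ j, P < j → q j = 0) (hqP : q P ≠ 0) :
    finrank K (V K (In n) Finset.univ (w K n n (expMul K lam q)) k) = (P + 1) * n.choose k := by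
  rw [finrank_V_w, rank_hankel1_expMul_of_order K lam hkP hq hqP, min_eq_left hPk, Nat.mul_comm]

/-- **THE DIVISOR IMAGE LAW.**  Distinct `λ_i`, `q_i` supported on `[0, P_i]` with `q_i(P_i) ≠ 0`, `D = Σ_i (P_i+1) ≤ k + 1` and `D ≤ n + 1 − k`:
**`V(univ, w_n(Σ_i expMul λ_i q_i), k) = ⨆_i V(univ, w_n(expMul λ_i q_i), k)`** and the sum has dimension `D·C(n,k) = Σ_i dim V_i`. -/
theorem V_w_expMul_sum {k r : ℕ} {lam : Fin r → K} (hlam : Function.Injective lam) {P : Fin r → ℕ} {q : Fin r → ℕ → K}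
    (hq : ∀ i j, P i < j → q i j = 0) (hqP : ∀ i, q i (P i) ≠ 0) (hDk : ∑ i, (P i + 1) ≤ k + 1) (hDn : ∑ i, (P i + 1) ≤ n + 1 - k) :
    V K (In n) Finset.univ (w K n n (fun j => ∑ i, expMul K (lam i) (q i) j)) k = ⨆ i, V K (In n) Finset.univ (w K n n (expMul K (lam i) (q i))) k ∧
      finrank K ↥(⨆ i, V K (In n) Finset.univ (w K n n (expMul K (lam i) (q i))) k) = (∑ i, (P i + 1)) * n.choose k := by
  have hPi : ∀ i, P i + 1 ≤ ∑ j, (P j + 1) := fun i => Finset.single_le_sum (fun j _ => Nat.zero_le (P j + 1)) (Finset.mem_univ i)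
  have hV : finrank K (V K (In n) Finset.univ (w K n n (fun j => ∑ i, expMul K (lam i) (q i) j)) k) = (∑ i, (P i + 1)) * n.choose k := by
    rw [finrank_V_w, rank_hankel1_expMul_sum K hlam hq hqP hDk hDn, Nat.mul_comm]
  have hVi : ∀ i, finrank K (V K (In n) Finset.univ (w K n n (expMul K (lam i) (q i))) k) = (P i + 1) * n.choose k := fun i =>
    finrank_V_w_expMul_of_order K (lam i) (by have := hPi i; omega) (by have := hPi i; omega) (hq i) (hqP i)
  have hsup : finrank K ↥(⨆ i, V K (In n) Finset.univ (w K n n (expMul K (lam i) (q i))) k) ≤ (∑ i, (P i + 1)) * n.choose k := by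
    rw [← Finset.sup_univ_eq_iSup, Finset.sum_mul]
    refine (finrank_finset_sup_le K Finset.univ _).trans (le_of_eq (Finset.sum_congr rfl fun i _ => hVi i))
  have hle := V_w_sum_le_iSup K (n := n) (fun i => expMul K (lam i) (q i)) k
  have hge : (∑ i, (P i + 1)) * n.choose k ≤ finrank K ↥(⨆ i, V K (In n) Finset.univ (w K n n (expMul K (lam i) (q i))) k) := by
    rw [← hV]; exact Submodule.finrank_mono hle
  exact ⟨Submodule.eq_of_le_of_finrank_le hle (by omega), le_antisymm hsup hge⟩

/-- the dimension count alone: **`dim ⨆_i V_i = Σ_i dim V_i = D·C(n,k)`**. -/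
theorem finrank_iSup_V_w_expMul {k r : ℕ} {lam : Fin r → K} (hlam : Function.Injective lam) {P : Fin r → ℕ} {q : Fin r → ℕ → K}
    (hq : ∀ i j, P i < j → q i j = 0) (hqP : ∀ i, q i (P i) ≠ 0) (hDk : ∑ i, (P i + 1) ≤ k + 1) (hDn : ∑ i, (P i + 1) ≤ n + 1 - k) :
    finrank K ↥(⨆ i, V K (In n) Finset.univ (w K n n (expMul K (lam i) (q i))) k) =
      ∑ i, finrank K (V K (In n) Finset.univ (w K n n (expMul K (lam i) (q i))) k) := by
  have hPi : ∀ i, P i + 1 ≤ ∑ j, (P j + 1) := fun i => Finset.single_le_sum (fun j _ => Nat.zero_le (P j + 1)) (Finset.mem_univ i)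
  rw [(V_w_expMul_sum K hlam hq hqP hDk hDn).2, Finset.sum_mul]
  exact Finset.sum_congr rfl fun i _ =>
    (finrank_V_w_expMul_of_order K (lam i) (by have := hPi i; omega) (by have := hPi i; omega) (hq i) (hqP i)).symm

/-- **THE SUM IS DIRECT: `iSupIndep (i ↦ V(univ, w_n(expMul λ_i q_i), k))`** — each node's image meets the sum of the other nodes' images in `0`
(dimension count: the whole sum already has dimension `Σ_i dim V_i`). -/
theorem iSupIndep_V_w_expMul {k r : ℕ} {lam : Fin r → K} (hlam : Function.Injective lam) {P : Fin r → ℕ} {q : Fin r → ℕ → K}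
    (hq : ∀ i j, P i < j → q i j = 0) (hqP : ∀ i, q i (P i) ≠ 0) (hDk : ∑ i, (P i + 1) ≤ k + 1) (hDn : ∑ i, (P i + 1) ≤ n + 1 - k) :
    iSupIndep (fun i => V K (In n) Finset.univ (w K n n (expMul K (lam i) (q i))) k) := by
  classical
  set F : Fin r → Submodule K (HT K (In n)) := fun i => V K (In n) Finset.univ (w K n n (expMul K (lam i) (q i))) k with hF
  have htot : finrank K ↥(⨆ i, F i) = ∑ i, finrank K (F i) := finrank_iSup_V_w_expMul K hlam hq hqP hDk hDn
  intro i
  -- the sum of the others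
  have hrest_eq : (⨆ (j) (_ : j ≠ i), F j) = (Finset.univ.erase i).sup F := by
    rw [Finset.sup_eq_iSup]
    refine iSup_congr fun j => ?_
    by_cases hj : j = i
    · subst hj; simp
    · simp [hj]
  have hrest : finrank K ↥(⨆ (j) (_ : j ≠ i), F j) ≤ ∑ j ∈ Finset.univ.erase i, finrank K (F j) := by
    rw [hrest_eq]; exact finrank_finset_sup_le K _ F
  have hsplit : (⨆ j, F j) = F i ⊔ ⨆ (j) (_ : j ≠ i), F j := by
    apply le_antisymm
    · refine iSup_le fun j => ?_
      by_cases hj : j = i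
      · subst hj; exact le_sup_left
      · exact (le_iSup₂ (f := fun j (_ : j ≠ i) => F j) j hj).trans le_sup_right
    · exact sup_le (le_iSup F i) (iSup₂_le fun j _ => le_iSup F j)
  have hsum : ∑ j, finrank K (F j) = finrank K (F i) + ∑ j ∈ Finset.univ.erase i, finrank K (F j) :=
    (Finset.add_sum_erase _ _ (Finset.mem_univ i)).symm
  have hdim := Submodule.finrank_sup_add_finrank_inf_eq (F i) (⨆ (j) (_ : j ≠ i), F j)
  rw [← hsplit, htot, hsum] at hdim
  have h0 : finrank K ↥(F i ⊓ ⨆ (j) (_ : j ≠ i), F j) = 0 := by omega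
  rw [disjoint_iff, Submodule.finrank_eq_zero.mp h0]

end Summit.Ventures.HSemireg.Wedge.HankelFrameChange
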